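import Literature.Geometry.Kaehler.ComplexTorusPolarizedProductOfCMEllipticCurves
import Literature.Geometry.Kaehler.ComplexTorusAppellHumbertHomPullback
import Literature.Geometry.Kaehler.ComplexTorusEllipticCurve
import HarnessLib

/-!
# Polarized products of CM elliptic curves, III: `R : f ↦ f_rat` is fully faithful on tori with
# `𝓞_K`-stable lattices, and polarized homomorphisms are the isometries of the hermitian lattices
# (Narbonne 2022, Theorem 1 and Theorem 2 on morphisms)

Layer `Literature/Geometry/Kaehler`, namespace `Literature.Geometry.Kaehler.ComplexTorus`; lane
`lit-hodgefound` (Track 2 foundations library), family `hodge`; sequel of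
`ComplexTorusPolarizedProductOfCMEllipticCurves` (Narbonne's Lemma 1 and Theorem 2 ON OBJECTS: the
polarizations of a torus with `R`-stable lattice, `R = φ(𝓞_K) = ℤ[ω₀]`, are the integral positive-definite
hermitian `R`-lattices `(Γ^{α_R}, h^{α_R})`).  THEOREMS ONLY: no definition, no named fact (net debt `0`).

## Source, VERBATIM

F. Narbonne, *Polarized products of elliptic curves with complex multiplication and field of moduli `ℚ`*,
arXiv:2203.11982 (2022) [Narbonne2022PolarizedProductsCM], held `paper:arxiv-2203.11982` p0005–p0007:

* §1.1 "Morphisms of complex tori are morphisms of groups `φ : X = V/Γ → X' = V'/Γ'`. Such maps can be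
  lifted to a linear maps `φ_an : V → V'` that sends `Γ` on `Γ'` called the analytic representation of `φ`.
  The group morphism `φ_rat = φ_an|_Γ : Γ → Γ'` is called the rational representation of `φ`."
* §1.3 "We define in the same way morphisms, `φ : (V/Γ, ρ_h) → (V'/Γ', ρ_{h'})` between polarized tori.
  Their analytic representation must satisfy `φ_an^* ρ_{h'} φ_an = ρ_h` which means that for `v, w ∈ V`,
  `ρ_h(v)(w) = h(v, w) = h'(φ_an(v), φ_an(w))`. In particular, analytic representations of polarized
  isogenies define isometries on the associated hermitian spaces."
* §2.2 "**Theorem 1.** Let `R` be an order in a quadratic imaginary field `K`. There is an equivalence of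
  categories between `AV_R` […] and `R-Lat`, `R`-lattices given by `R : A s.t. A(ℂ) ≃ V/Γ ↦ Γ`,
  `(ℂ ⊗ L)/L ↤ L` on objects and for `f : A(ℂ) ≃ V/Γ → A'(ℂ) ≃ V'/Γ'`, `R(f) = f_rat`."  Proof: "Finally,
  given a morphism `f : V/Γ → V'/Γ'`, `R(f) = f_rat : Γ → Γ'` and since `f_rat = f_an|_Γ` and `f_an` is
  `ℂ`-linear, and then `R`-linear, it is clear that `R` maps arrows in a full and faithful way."
  "If we consider the functor `R` from abelian varieties over `ℂ` without restriction to the category of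
  sub `ℤ`-lattices of a finite dimensional `ℂ`-vector space `R` is not essentially surjective. […] Even if
  we restrict `R` on its essential image it is not full. Indeed, even in dimension `1` there are
  morphisms of polarizable `ℤ`-lattices (i.e., morphisms of groups) which are not the restriction of a
  `ℂ`-linear map. Hence, the structure of `ℤ`-module is not enough. Fortunately, considering the
  `R`-module structure given by the complex multiplication makes `R` an equivalence."
* §2.3 "**Theorem 2.** With the notations above there is an equivalence of categories given on objects
  by `PT_R → Rh-Lat`, `(X = V/Γ, ρ_h) ↦ (Γ^{α_R}, h^{α_R})` […]."

## What is formalised (theorems only), and on which carriers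

`X = E/Ψ(ℤ^ι)`, `X' = E'/Ψ'(ℤ^{ι'})`; a homomorphism `X → X'` is (Lange–Birkenhake §1.2, the tree's
`mapMatrix` / `IsRiemannForm.pullback` shape) an integer matrix `A : Matrix ι' ι ℤ` — the rational
representation `f_rat` on lattice coordinates, `γ = Ψm ↦ Ψ'(Am)` — TOGETHER with a `ℂ`-linear analytic
representation `f : E →L[ℂ] E'` with `Ψ' ∘ A_ℝ = f ∘ Ψ`.  `K` has an integral basis `b = (1, ω₀)`,
`φ : K →+* ℂ` with `Im φ(ω₀) ≠ 0`, `R = φ(𝓞_K)`; "`Γ` is an `R`-module" is the hypothesis `hΛ` of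
`ComplexTorusProductOfCMEllipticCurves`; "`f_rat` is `R`-linear" reads
`φ(r)Ψm = Ψm₁ ⇒ φ(r)Ψ'(Am) = Ψ'(Am₁)`.

* §1 FAITHFUL: `linearMap_eq_of_latticeVec` (an `ℝ`-linear map is determined by its values on `Γ`;
  "`f_rat = f_an|_Γ`" determines `f_an` — the tree's `analyticRep_unique`, `ComplexTorusHomLift`);
  `equivariant_of_analyticRep` ("`f_an` is `ℂ`-linear, and then `R`-linear").
* §2 FULL: **`exists_analyticRep_of_equivariant`** — an `R`-linear lattice map `A` IS the rational
  representation of a homomorphism: `F = Ψ' A_ℝ Ψ⁻¹` commutes with multiplication by `φ(ω₀)` on `Γ`,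
  hence on `V = ℝΓ`, hence is `ℂ = ℝ + ℝφ(ω₀)`-linear; **`exists_analyticRep_iff_equivariant`**
  (`Hom(X, X') = Hom_R(Γ, Γ')`: "`R` maps arrows in a full and faithful way").
* §3 "the structure of `ℤ`-module is not enough": **`not_exists_analyticRep_swap_ellipticPeriod_I`** —
  on `E_i = ℂ/(ℤi + ℤ)` the lattice automorphism `i ↔ 1` is not the rational representation of any
  endomorphism (the printed dimension-`1` counter-example).
* §4 THEOREM 2 ON MORPHISMS (with the tree's `hermOf_pullbackForm`, `h_{f^*ω'}(u, v) = h'(fu, fv)`):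
  **`pullbackForm_eq_iff_forall_hermOf_eq`** (`f^*ω' = ω ⟺ f_an` is an isometry `h'(fu, fv) = h(u, v)`),
  `pullbackForm_eq_iff_forall_hermOf_latticeVec_eq` (`⟺ f_rat` is an isometry of the lattices
  `(Γ^α, h^α) → (Γ'^α, h'^α)`), and **`exists_analyticRep_pullbackForm_eq_iff`**: the polarized
  homomorphisms `(X, ω) → (X', ω')` with rational representation `A` are exactly the `R`-linear
  isometries `A` of the integral hermitian lattices (`Hom_{PT_R} = Hom_{Rh-Lat}`).

NOT here: the categories `AV_R`, `PT_R`, `R-Lat`, `Rh-Lat` as `CategoryTheory` instances (the torus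
layer of the tree has none; the statements above are the Hom-set bijections), §3–§4 of the paper.

## References
* [Narbonne2022PolarizedProductsCM] F. Narbonne, arXiv:2203.11982 (2022), §1.1, §1.3, §2.2 Thm. 1,
  §2.3 Thm. 2.
* [LangeBirkenhake1992] H. Lange, Ch. Birkenhake, *Complex Abelian Varieties* (1992), §1.2 (analytic and
  rational representations).
-/

noncomputable section

open Module Complex NumberField
open scoped ComplexConjugate

namespace Literature.Geometry.Kaehler

namespace ComplexTorus

variable {K : Type} [Field K] (φ : K →+* ℂ)
variable {ι ι' : Type*} {E E' : Type*} [NormedAddCommGroup E] [NormedSpace ℂ E]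
  [NormedAddCommGroup E'] [NormedSpace ℂ E']

/-! ## §1. Faithful: `f_rat = f_an|_Γ` determines `f_an`, and `f_rat` is `R`-linear -/

section Faithful

variable [Fintype ι] [DecidableEq ι]

omit [NormedSpace ℂ E'] in
/-- **Two `ℝ`-linear maps agreeing on the lattice `Γ = Ψ(ℤ^ι)` are equal** (`Γ` contains an `ℝ`-basis
of `V`). [cite: LangeBirkenhake1992, §1.2 (the analytic representation is determined by the rational one)] -/
theorem linearMap_eq_of_latticeVec [Module ℝ E'] (Ψ : (ι → ℝ) ≃L[ℝ] E) {F G : E →ₗ[ℝ] E'}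
    (h : ∀ m : ι → ℤ, F (latticeVec Ψ m) = G (latticeVec Ψ m)) : F = G := by
  have hΨ : F ∘ₗ (Ψ : (ι → ℝ) →ₗ[ℝ] E) = G ∘ₗ (Ψ : (ι → ℝ) →ₗ[ℝ] E) := by
    refine (Pi.basisFun ℝ ι).ext fun i ↦ ?_
    rw [Pi.basisFun_apply, LinearMap.comp_apply, LinearMap.comp_apply, ← intVec_single]
    exact h (Pi.single i 1)
  ext u
  have := congrArg (fun L : (ι → ℝ) →ₗ[ℝ] E' ↦ L (Ψ.symm u)) hΨ
  simpa using this

omit [DecidableEq ι] in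
/-- **"`f_an` is `ℂ`-linear, and then `R`-linear"**: the rational representation `A` of a homomorphism
with `ℂ`-linear analytic representation `f` is `R`-linear on the lattices — if `φ(r)·Ψm = Ψm₁` then
`φ(r)·Ψ'(Am) = Ψ'(Am₁)`. [cite: Narbonne2022PolarizedProductsCM, §2.2 Thm. 1 (proof)] -/
theorem equivariant_of_analyticRep [Fintype ι'] (Ψ : (ι → ℝ) ≃L[ℝ] E) (Ψ' : (ι' → ℝ) ≃L[ℝ] E')
    {A : Matrix ι' ι ℤ} {f : E →L[ℂ] E'} (hf : ∀ x, Ψ' ((A.map (Int.cast : ℤ → ℝ)).mulVec x) = f (Ψ x))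
    (r : 𝓞 K) {m m₁ : ι → ℤ} (hm : (φ (r : K)) • latticeVec Ψ m = latticeVec Ψ m₁) :
    (φ (r : K)) • latticeVec Ψ' (A.mulVec m) = latticeVec Ψ' (A.mulVec m₁) := by
  change (φ (r : K)) • Ψ' (intVec (A.mulVec m)) = Ψ' (intVec (A.mulVec m₁))
  rw [← intVec_mulVec, ← intVec_mulVec, hf, hf, ← map_smul]
  change f ((φ (r : K)) • latticeVec Ψ m) = f (latticeVec Ψ m₁)
  rw [hm]

end Faithful

/-! ## §2. Full: an `R`-linear lattice map is the rational representation of a homomorphism -/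

section Full

variable [Fintype ι] [Fintype ι'] [DecidableEq ι]

omit [Fintype ι'] in
/-- **Narbonne 2022, Theorem 1 on morphisms — FULL: "considering the `R`-module structure given by the
complex multiplication makes `R` an equivalence".**  Let `X = E/Ψ(ℤ^ι)`, `X' = E'/Ψ'(ℤ^{ι'})` have
`R`-stable lattices, `R = φ(𝓞_K) = ℤ[ω₀]` with `Im φ(ω₀) ≠ 0`, and let `A : ℤ^ι → ℤ^{ι'}` be an additive
map of the lattices (`γ = Ψm ↦ Ψ'(Am)`) which is `R`-LINEAR (`φ(r)Ψm = Ψm₁ ⇒ φ(r)Ψ'(Am) = Ψ'(Am₁)`).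
Then `A` is the rational representation of a homomorphism of complex tori: the `ℝ`-linear extension
`F = Ψ' A_ℝ Ψ⁻¹ : V → V'` of the lattice map is `ℂ`-linear — it commutes with multiplication by `φ(ω₀)`
on `Γ`, hence on `V = ℝΓ`, and `ℂ = ℝ + ℝφ(ω₀)`.
[cite: Narbonne2022PolarizedProductsCM, §2.2 Thm. 1 (proof: "`R` maps arrows in a full … way")] -/
theorem exists_analyticRep_of_equivariant (b : Basis (Fin 2) ℤ (𝓞 K)) (hφ : (φ (b 1 : K)).im ≠ 0)
    (Ψ : (ι → ℝ) ≃L[ℝ] E) (Ψ' : (ι' → ℝ) ≃L[ℝ] E')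
    (hΛ : ∀ (a : 𝓞 K) (m : ι → ℤ), ∃ m' : ι → ℤ, (φ (a : K)) • latticeVec Ψ m = latticeVec Ψ m')
    (A : Matrix ι' ι ℤ)
    (hA : ∀ (r : 𝓞 K) (m m₁ : ι → ℤ), (φ (r : K)) • latticeVec Ψ m = latticeVec Ψ m₁ →
      (φ (r : K)) • latticeVec Ψ' (A.mulVec m) = latticeVec Ψ' (A.mulVec m₁)) :
    ∃ f : E →L[ℂ] E', ∀ x, Ψ' ((A.map (Int.cast : ℤ → ℝ)).mulVec x) = f (Ψ x) := by
  set w : ℂ := φ (b 1 : K) with hw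
  -- the `ℝ`-linear extension `F = Ψ' ∘ A_ℝ ∘ Ψ⁻¹`
  set Aℝ : (ι → ℝ) →L[ℝ] (ι' → ℝ) :=
    LinearMap.toContinuousLinearMap (Matrix.mulVecLin (A.map (Int.cast : ℤ → ℝ))) with hAℝ
  set F : E →L[ℝ] E' := (Ψ' : (ι' → ℝ) →L[ℝ] E').comp (Aℝ.comp (Ψ.symm : E →L[ℝ] (ι → ℝ)))
    with hFdef
  have hF : ∀ x, F (Ψ x) = Ψ' ((A.map (Int.cast : ℤ → ℝ)).mulVec x) := fun x ↦ by
    simp [hFdef, hAℝ]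
  -- `F(w·u) = w·F(u)`: both sides are `ℝ`-linear in `u` and agree on `Γ`
  have hFw : ∀ u : E, F (w • u) = w • F u := by
    let L₁ : E →ₗ[ℝ] E' := (F : E →ₗ[ℝ] E') ∘ₗ ((w • LinearMap.id : E →ₗ[ℂ] E).restrictScalars ℝ)
    let L₂ : E →ₗ[ℝ] E' := ((w • LinearMap.id : E' →ₗ[ℂ] E').restrictScalars ℝ) ∘ₗ (F : E →ₗ[ℝ] E')
    have hL : L₁ = L₂ := by
      refine linearMap_eq_of_latticeVec Ψ fun m ↦ ?_
      obtain ⟨m₁, hm₁⟩ := hΛ (b 1) m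
      change F (w • latticeVec Ψ m) = w • F (latticeVec Ψ m)
      rw [hm₁]
      change F (Ψ (intVec m₁)) = w • F (Ψ (intVec m))
      rw [hF, hF, intVec_mulVec, intVec_mulVec]
      have h := hA (b 1) m m₁ hm₁
      exact h.symm
    intro u
    exact congrArg (fun L : E →ₗ[ℝ] E' ↦ L u) hL
  -- hence `ℂ`-linear: `c = t + s·w` with `s = Im c / Im w`, `t = Re c − s Re w`
  have hsmul : ∀ (c : ℂ) (u : E), F (c • u) = c • F u := by
    intro c u
    set s : ℝ := c.im / w.im with hs
    set t : ℝ := c.re - s * w.re with ht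
    have hc : c = (t : ℂ) + (s : ℂ) * w := by
      apply Complex.ext
      · simp [ht]
      · simp only [Complex.add_im, Complex.ofReal_im, Complex.mul_im, Complex.ofReal_re, zero_mul,
          add_zero, zero_add, hs]
        field_simp
    have hcu : ∀ v : E, c • v = t • v + s • (w • v) := fun v ↦ by
      rw [hc, add_smul, mul_smul, Complex.coe_smul, Complex.coe_smul]
    have hcu' : ∀ v : E', c • v = t • v + s • (w • v) := fun v ↦ by
      rw [hc, add_smul, mul_smul, Complex.coe_smul, Complex.coe_smul]
    rw [hcu u, map_add, map_smul, map_smul, hFw, hcu' (F u)]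
  refine ⟨{ toFun := F, map_add' := F.map_add, map_smul' := hsmul, cont := F.continuous }, fun x ↦ ?_⟩
  exact (hF x).symm

/-- **Narbonne 2022, Theorem 1 on morphisms: "`R` maps arrows in a full and faithful way"** —
`Hom(X, X') = Hom_R(Γ, Γ')`: an additive map `A` of the `R`-stable lattices is the rational
representation of a (unique, `analyticRep_unique`) homomorphism of complex tori `X → X'` IFF it is
`R`-linear.  ("Even in dimension `1` there are morphisms of polarizable `ℤ`-lattices which are not the
restriction of a `ℂ`-linear map … the `R`-module structure … makes `R` an equivalence.")
[cite: Narbonne2022PolarizedProductsCM, §2.2 Thm. 1] -/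
theorem exists_analyticRep_iff_equivariant (b : Basis (Fin 2) ℤ (𝓞 K)) (hφ : (φ (b 1 : K)).im ≠ 0)
    (Ψ : (ι → ℝ) ≃L[ℝ] E) (Ψ' : (ι' → ℝ) ≃L[ℝ] E')
    (hΛ : ∀ (a : 𝓞 K) (m : ι → ℤ), ∃ m' : ι → ℤ, (φ (a : K)) • latticeVec Ψ m = latticeVec Ψ m')
    (A : Matrix ι' ι ℤ) :
    (∃ f : E →L[ℂ] E', ∀ x, Ψ' ((A.map (Int.cast : ℤ → ℝ)).mulVec x) = f (Ψ x)) ↔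
      ∀ (r : 𝓞 K) (m m₁ : ι → ℤ), (φ (r : K)) • latticeVec Ψ m = latticeVec Ψ m₁ →
        (φ (r : K)) • latticeVec Ψ' (A.mulVec m) = latticeVec Ψ' (A.mulVec m₁) :=
  ⟨fun ⟨_, hf⟩ r _ _ hm ↦ equivariant_of_analyticRep φ Ψ Ψ' hf r hm,
    exists_analyticRep_of_equivariant φ b hφ Ψ Ψ' hΛ A⟩

end Full

/-! ## §3. "The structure of `ℤ`-module is not enough": the dimension-one counter-example -/

section CounterExample

/-- **"Even in dimension `1` there are morphisms of polarizable `ℤ`-lattices (i.e., morphisms of groups)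
which are not the restriction of a `ℂ`-linear map"**: on `E_i = ℂ/(ℤi + ℤ)` (`Ψ(x) = x₀ i + x₁`) the
lattice automorphism `(m₀, m₁) ↦ (m₁, m₀)`, i.e. `i ↔ 1`, is not the rational representation of any
endomorphism — a `ℂ`-linear `f` with `f(1) = i` has `f(i) = i·f(1) = −1 ≠ 1`.
[cite: Narbonne2022PolarizedProductsCM, §2.2 (remark after Thm. 1)] -/
theorem not_exists_analyticRep_swap_ellipticPeriod_I :
    ¬ ∃ f : ℂ →L[ℂ] ℂ, ∀ x : Fin 2 → ℝ,
      ellipticPeriod (τ := I) (by simp) ((!![0, 1; 1, 0] : Matrix (Fin 2) (Fin 2) ℤ).map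
        (Int.cast : ℤ → ℝ) |>.mulVec x) = f (ellipticPeriod (τ := I) (by simp) x) := by
  rintro ⟨f, hf⟩
  have h1 := hf ![0, 1]
  have h2 := hf ![1, 0]
  simp [Matrix.mulVec, dotProduct, Fin.sum_univ_two, ellipticPeriod_apply] at h1 h2
  -- `h1 : I = f 1`, `h2 : 1 = f I`
  have h3 : f I = I * f 1 := by rw [← smul_eq_mul, ← map_smul, smul_eq_mul, mul_one]
  rw [← h1, ← h2, Complex.I_mul_I] at h3
  norm_num at h3

end CounterExample

/-! ## §4. Theorem 2 on morphisms: polarized homomorphisms are the isometries of `(Γ^α, h^α)` -/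

section Isometry

/-- **"`φ_an^* ρ_{h'} φ_an = ρ_h` means that for `v, w ∈ V`, `h(v, w) = h'(φ_an(v), φ_an(w))`"**: for a
`ℂ`-linear `f`, `f^*ω' = ω` iff `f` is an isometry of the hermitian forms `h = hermOf ω`,
`h' = hermOf ω'` ("analytic representations of polarized isogenies define isometries on the associated
hermitian spaces"). [cite: Narbonne2022PolarizedProductsCM, §1.3] -/
theorem pullbackForm_eq_iff_forall_hermOf_eq (f : E →L[ℂ] E') (ω : E [⋀^Fin 2]→L[ℝ] ℝ)
    (ω' : E' [⋀^Fin 2]→L[ℝ] ℝ) :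
    pullbackForm f ω' = ω ↔ ∀ u v : E, hermOf ω' (f u) (f v) = hermOf ω u v := by
  constructor
  · rintro rfl u v
    rw [hermOf_pullbackForm]
  · intro h
    exact eq_of_hermOf_eq fun u v ↦ by rw [hermOf_pullbackForm, h]

variable [Fintype ι] [DecidableEq ι]

omit [NormedSpace ℂ E'] in
/-- Two real-bilinear maps `E × E → ℂ` (additive and `ℝ`-homogeneous in each slot) agreeing on
`Γ × Γ` agree. [cite: LangeBirkenhake1992, §1.2] -/
private theorem bilin_eq_of_latticeVec (Ψ : (ι → ℝ) ≃L[ℝ] E) {P Q : E → E → ℂ}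
    (hPadd₁ : ∀ u u' v, P (u + u') v = P u v + P u' v) (hPsmul₁ : ∀ (r : ℝ) u v, P (r • u) v = r • P u v)
    (hPadd₂ : ∀ u v v', P u (v + v') = P u v + P u v') (hPsmul₂ : ∀ (r : ℝ) u v, P u (r • v) = r • P u v)
    (hQadd₁ : ∀ u u' v, Q (u + u') v = Q u v + Q u' v) (hQsmul₁ : ∀ (r : ℝ) u v, Q (r • u) v = r • Q u v)
    (hQadd₂ : ∀ u v v', Q u (v + v') = Q u v + Q u v') (hQsmul₂ : ∀ (r : ℝ) u v, Q u (r • v) = r • Q u v)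
    (h : ∀ m m' : ι → ℤ, P (latticeVec Ψ m) (latticeVec Ψ m') = Q (latticeVec Ψ m) (latticeVec Ψ m'))
    (u v : E) : P u v = Q u v := by
  -- first fix a lattice vector in the second slot
  have h1 : ∀ (m' : ι → ℤ) (u : E), P u (latticeVec Ψ m') = Q u (latticeVec Ψ m') := by
    intro m' u
    let L₁ : E →ₗ[ℝ] ℂ :=
      { toFun := fun u ↦ P u (latticeVec Ψ m')
        map_add' := fun u u' ↦ hPadd₁ u u' _
        map_smul' := fun r u ↦ hPsmul₁ r u _ }
    let L₂ : E →ₗ[ℝ] ℂ :=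
      { toFun := fun u ↦ Q u (latticeVec Ψ m')
        map_add' := fun u u' ↦ hQadd₁ u u' _
        map_smul' := fun r u ↦ hQsmul₁ r u _ }
    have hL : L₁ = L₂ := linearMap_eq_of_latticeVec Ψ fun m ↦ h m m'
    exact congrArg (fun L : E →ₗ[ℝ] ℂ ↦ L u) hL
  let L₁ : E →ₗ[ℝ] ℂ :=
    { toFun := fun v ↦ P u v
      map_add' := fun v v' ↦ hPadd₂ u v v'
      map_smul' := fun r v ↦ hPsmul₂ r u v }
  let L₂ : E →ₗ[ℝ] ℂ :=
    { toFun := fun v ↦ Q u v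
      map_add' := fun v v' ↦ hQadd₂ u v v'
      map_smul' := fun r v ↦ hQsmul₂ r u v }
  have hL : L₁ = L₂ := linearMap_eq_of_latticeVec Ψ fun m' ↦ h1 m' u
  exact congrArg (fun L : E →ₗ[ℝ] ℂ ↦ L v) hL

/-- `h(v, w + w') = h(v, w) + h(v, w')`, and `h(v, r·w) = r·h(v, w)` for real `r`: the hermitian form is
real-bilinear (for ANY real `2`-form). [cite: Lange2023AbelianVarietiesComplex, §1.2.2 Lemma 1.2.10] -/
private theorem hermOf_real_smul_right (η : E [⋀^Fin 2]→L[ℝ] ℝ) (r : ℝ) (v w : E) :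
    hermOf η v (r • w) = (r : ℂ) * hermOf η v w := by
  simp only [hermOf_apply, twoForm_smul_right, Complex.ofReal_mul]
  ring

/-- **`f^*ω' = ω` iff `f_rat` is an isometry of the lattices** `(Γ, h|_Γ) → (Γ', h'|_{Γ'})` — isometry on
`Γ × Γ` suffices (`Γ` spans `V` over `ℝ` and both hermitian forms are real-bilinear); equivalently (any
`α ≠ 0`) an isometry `(Γ^α, h^α) → (Γ'^α, h'^α)` of Narbonne's scaled hermitian lattices.
[cite: Narbonne2022PolarizedProductsCM, §1.3 and §2.3 Thm. 2] -/
theorem pullbackForm_eq_iff_forall_hermOf_latticeVec_eq [Fintype ι'] (Ψ : (ι → ℝ) ≃L[ℝ] E)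
    (Ψ' : (ι' → ℝ) ≃L[ℝ] E') {A : Matrix ι' ι ℤ} {f : E →L[ℂ] E'}
    (hf : ∀ x, Ψ' ((A.map (Int.cast : ℤ → ℝ)).mulVec x) = f (Ψ x)) (ω : E [⋀^Fin 2]→L[ℝ] ℝ)
    (ω' : E' [⋀^Fin 2]→L[ℝ] ℝ) {α : ℂ} (hα : α ≠ 0) :
    pullbackForm f ω' = ω ↔ ∀ m m' : ι → ℤ,
      α * hermOf ω' (latticeVec Ψ' (A.mulVec m)) (latticeVec Ψ' (A.mulVec m')) =
        α * hermOf ω (latticeVec Ψ m) (latticeVec Ψ m') := by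
  have hfl : ∀ m : ι → ℤ, f (latticeVec Ψ m) = latticeVec Ψ' (A.mulVec m) := fun m ↦ by
    change f (Ψ (intVec m)) = Ψ' (intVec (A.mulVec m))
    rw [← intVec_mulVec, hf]
  rw [pullbackForm_eq_iff_forall_hermOf_eq]
  constructor
  · intro h m m'
    rw [← hfl, ← hfl, h]
  · intro h u v
    refine bilin_eq_of_latticeVec Ψ (P := fun u v ↦ hermOf ω' (f u) (f v)) (Q := fun u v ↦ hermOf ω u v)
      (fun u u' v ↦ by simp only [map_add, hermOf_add_left])
      (fun r u v ↦ by
        simp only [ContinuousLinearMap.map_smul_of_tower, hermOf_real_smul_left, Complex.real_smul])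
      (fun u v v' ↦ by simp only [map_add, hermOf_add_right])
      (fun r u v ↦ by
        simp only [ContinuousLinearMap.map_smul_of_tower, hermOf_real_smul_right, Complex.real_smul])
      (fun u u' v ↦ hermOf_add_left ω u u' v)
      (fun r u v ↦ by simp only [hermOf_real_smul_left, Complex.real_smul])
      (fun u v v' ↦ hermOf_add_right ω u v v')
      (fun r u v ↦ by simp only [hermOf_real_smul_right, Complex.real_smul])
      (fun m m' ↦ ?_) u v
    have h' := h m m'
    rw [hfl, hfl]
    exact mul_left_cancel₀ hα h'

/-- **Narbonne 2022, Theorem 2 on morphisms: `Hom_{PT_R}((X, ρ_h), (X', ρ_{h'})) =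
Hom_{Rh-Lat}((Γ^{α_R}, h^{α_R}), (Γ'^{α_R}, h'^{α_R}))`.**  For tori `X`, `X'` with `R`-stable lattices
and polarizations `ω`, `ω'` (`h = hermOf ω`, `h' = hermOf ω'`, `α = Im φ(ω₀) ≠ 0`), an additive lattice
map `A` is the rational representation of a POLARIZED homomorphism (`ℂ`-linear analytic representation
`f` with `f^*ω' = ω`) iff `A` is `R`-linear and an isometry `α·h'(Aγ, Aγ') = α·h(γ, γ')` of the integral
hermitian lattices of FILE 1 — Theorem 1's full faithfulness plus §1.3's "polarized isogenies define
isometries". [cite: Narbonne2022PolarizedProductsCM, §2.3 Thm. 2 (with §1.3 and Thm. 1)] -/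
theorem exists_analyticRep_pullbackForm_eq_iff [Fintype ι'] (b : Basis (Fin 2) ℤ (𝓞 K))
    (hφ : (φ (b 1 : K)).im ≠ 0) (Ψ : (ι → ℝ) ≃L[ℝ] E) (Ψ' : (ι' → ℝ) ≃L[ℝ] E')
    (hΛ : ∀ (a : 𝓞 K) (m : ι → ℤ), ∃ m' : ι → ℤ, (φ (a : K)) • latticeVec Ψ m = latticeVec Ψ m')
    (ω : E [⋀^Fin 2]→L[ℝ] ℝ) (ω' : E' [⋀^Fin 2]→L[ℝ] ℝ) (A : Matrix ι' ι ℤ) :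
    (∃ f : E →L[ℂ] E', (∀ x, Ψ' ((A.map (Int.cast : ℤ → ℝ)).mulVec x) = f (Ψ x)) ∧
        pullbackForm f ω' = ω) ↔
      (∀ (r : 𝓞 K) (m m₁ : ι → ℤ), (φ (r : K)) • latticeVec Ψ m = latticeVec Ψ m₁ →
        (φ (r : K)) • latticeVec Ψ' (A.mulVec m) = latticeVec Ψ' (A.mulVec m₁)) ∧
      ∀ m m' : ι → ℤ,
        ((φ (b 1 : K)).im : ℂ) * hermOf ω' (latticeVec Ψ' (A.mulVec m)) (latticeVec Ψ' (A.mulVec m')) =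
          ((φ (b 1 : K)).im : ℂ) * hermOf ω (latticeVec Ψ m) (latticeVec Ψ m') := by
  have hα : ((φ (b 1 : K)).im : ℂ) ≠ 0 := Complex.ofReal_ne_zero.mpr hφ
  constructor
  · rintro ⟨f, hf, hfω⟩
    exact ⟨fun r m m₁ hm ↦ equivariant_of_analyticRep φ Ψ Ψ' hf r hm,
      (pullbackForm_eq_iff_forall_hermOf_latticeVec_eq Ψ Ψ' hf ω ω' hα).1 hfω⟩
  · rintro ⟨hA, hiso⟩
    obtain ⟨f, hf⟩ := exists_analyticRep_of_equivariant φ b hφ Ψ Ψ' hΛ A hA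
    exact ⟨f, hf, (pullbackForm_eq_iff_forall_hermOf_latticeVec_eq Ψ Ψ' hf ω ω' hα).2 hiso⟩

omit [DecidableEq ι] in
/-- **Polarized homomorphisms preserve polarizations**: if `(A, f)` is a homomorphism with `f`
injective and `ω'` is a polarization of `X'`, then `f^*ω'` is a polarization of `X` (the tree's
`IsRiemannForm.pullback`), and its hermitian lattice is the pull-back lattice `h(γ, γ') = h'(Aγ, Aγ')`
— the functor `(X, ρ_h) ↦ (Γ^{α_R}, h^{α_R})` on arrows.
[cite: Narbonne2022PolarizedProductsCM, §1.3 and §2.3 Thm. 2] -/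
theorem IsRiemannForm.pullback_hermOf_latticeVec [Fintype ι'] (Ψ : (ι → ℝ) ≃L[ℝ] E)
    (Ψ' : (ι' → ℝ) ≃L[ℝ] E') {A : Matrix ι' ι ℤ} {f : E →L[ℂ] E'}
    (hf : ∀ x, Ψ' ((A.map (Int.cast : ℤ → ℝ)).mulVec x) = f (Ψ x)) (hinj : Function.Injective f)
    {ω' : E' [⋀^Fin 2]→L[ℝ] ℝ} (hω' : IsRiemannForm Ψ' ω') :
    IsRiemannForm Ψ (pullbackForm f ω') ∧ ∀ m m' : ι → ℤ,
      hermOf (pullbackForm f ω') (latticeVec Ψ m) (latticeVec Ψ m') =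
        hermOf ω' (latticeVec Ψ' (A.mulVec m)) (latticeVec Ψ' (A.mulVec m')) := by
  refine ⟨hω'.pullback Ψ Ψ' hf hinj, fun m m' ↦ ?_⟩
  rw [hermOf_pullbackForm]
  change hermOf ω' (f (Ψ (intVec m))) (f (Ψ (intVec m'))) =
    hermOf ω' (Ψ' (intVec (A.mulVec m))) (Ψ' (intVec (A.mulVec m')))
  rw [← intVec_mulVec, ← intVec_mulVec, hf, hf]

end Isometry

end ComplexTorus

end Literature.Geometry.Kaehler

end
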